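import Mathlib
import Literature.MathematicalPhysics.QuantumFieldTheory.Balaban1983to89.B5RealFields
import Summits.QuantumFields.BalabanUV.T4Continuum.Support.SliceFlatPropagator
import Summits.QuantumFields.BalabanUV.T4Continuum.Support.SliceCovariantPrincipal
import Summits.QuantumFields.BalabanUV.T4Continuum.Support.SliceTorusComb

/-!
# T⁴ programme, node NE3 (η-rate of the minimisers) — THE FLAT RUNG, part 2: the flat propagators ARE the operators
# `gLevE` of the lineage's one type at the flat data, their POSITIVITY is a theorem, and (3.42) item 0 in kernel form
# holds for `gLevE` itself

Thirteenth generation of the NE3 prover lineage P1 of the cell `pub-balaban`, file 6.  Part 1 (`SliceFlatPropagator`,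
p199042) transported Bałaban's `U = 1` propagator `(Δ_1)⁻¹` of [B5] (1.73) (pv15's `(DeltaA n M 1)⁻¹`) to the NE3 carrier
as `gFlat j = (L^{min(j,k)})²·Re(…)⁻¹` and PROVED the skeleton's binder `hG` for it.  The lineage's one type
(`SliceCovariantPrincipal.ne3Shape_torusCovE_of_printedStatements`, p198587) speaks about `G := gLevE E Kc Rm wB aB Ng j =
(E + a_j·Q_j(U)ᵀQ_j(U) + N_j)⁻¹`.  THIS FILE identifies the two at the FLAT DATA:
 * §1 the reindexing of matrices `RI j A = reindex Φ_j Φ_j A` along `Φ_j = PhiF j = ((eF j) × id)⁻¹` (products, units) and the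
   unit-lattice level operator `kFlat j := η_j² • RI j (B5RealFields.DeltaAR n M 1)` (pv15's REAL matrix `Re Δ_1`, their
   `isReal_DeltaA`) with `gFlat j = η_j⁻² • RI j GR` (`gFlat_eq`), `kFlat j * gFlat j = 1 = gFlat j * kFlat j` (pv15's
   `DeltaAR_mul_GR`/`GR_mul_DeltaAR`), `kFlat_posDef` (pv15's `DeltaAR_posDef` = [B5] Prop. 1.1 ∕ (1.73) «Δ_a is a positive
   operator», transported);
 * §2 THE FLAT DATA of the covariant skeleton: identity transport `flatRm` (isometric: `SliceTorusComb.flat_isometric`), the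
   tower combs `SliceTorusComb.cubeComb` (`blk = cube` by `rfl`), masses `am ≡ 1` (pv15's `a = 1`), the LEVEL-FREE principal
   part `flatE := RI 0 (LapR 1 M₀)` (the unit vector Laplacian `Σ_ν ∇_ν*∇_ν` of [B5] (1.90) transported from level 0, where
   `η = 1`), and the gauge∕remainder forms `flatNg j := kFlat j − flatE − massKernel (cubeI j) τ_j (1/(L^j)^{d+3})` — DEFINED
   as the remainder (it CONTAINS Bałaban's `−η²∂P_j∂*` of (1.69)–(1.70), the deviation of the line-average `Q` of (1.8)
   from the block-diagonal mass model, and the difference `η_j²·RI j LapR_j − flatE`, which vanishes but is not proved to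
   here — the stencil lemma is the successor's);
 * §3 **`kLevE_flat`**: `kLevE flatE (cubeComb) flatRm wB (aB 1) flatNg j = kFlat j` (by `kPart_eq_massKernel` + the
   definition of `flatNg`), hence **`gLevE_flat : gLevE … j = gFlat j`** (`Matrix.inv_eq_left_inv`), **`posDef_kLevE_flat`**
   (the binder behind `hT311` — [B9] Theorem 3.11 at `U = 1` — is a THEOREM for the flat data), and
   **`gLevE_flat_rowBound`** = `gFlat_rowBound` for `gLevE` itself: (3.42) ITEM 0 IN KERNEL FORM, LEVEL-FREE CONSTANTS,
   PROVED FOR THE OPERATOR FAMILY OF THE LINEAGE'S ONE TYPE AT THE FLAT BACKGROUND.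
WHAT THIS BUYS (honest, and nothing more): of the stability readings of `ne3Shape_torusCovE_of_printedStatements`, at `U = 1`
the positivity `hT311` and the `m = 0` row clause of `hT31` (3.42) are now THEOREMS about the skeleton's own defined
operators (from pv15's formalisation of [B5]); the `m = 1` clause (`∇G`, `G∇*` — the skeleton's `hGD`) is not in pv15's
tree, (3.49) for `flatNg` is not attempted (its honest content waits for the stencil lemma and pv15's `PcT` kernel bounds),
and `U ≠ 1` is [B9] Thms 3.1∕3.3∕3.11, printed, by name.  NE3 is NOT proved.

Honest framing: finite-T⁴ ultraviolet bookkeeping about MINIMISERS (rung (B)+1 of the cell's ladder); no conditional of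
the cell (`BetaPertH`, (B), (B^μ)) is used or hidden; nothing bears on infinite volume, a mass gap, or the Clay problem.
ABSOLUTE RULE of the cell kept: nothing printed is used as a hypothesis — inputs are kernel-proved tree modules only
(pv15's `B5RealFields`, `B5G183FreeRowSum` via part 1; the lineage's torus series).  No `sorry`, no axioms beyond
Mathlib's.  PLACEMENT (human rule 2026-08-19): cell work under `Summits/QuantumFields/BalabanUV/`; imports
`Support.SliceFlatPropagator` (p199042), `Support.SliceCovariantPrincipal` (p198587), `Support.SliceTorusComb` (p198383),
pv15's `B5RealFields`; moves nothing.  Records: `t4/T4-EST-U1b-OSC.md` v1.26 (RESULT 34), `t4/T4-EST-NE3-P1.md` v2.25,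
GAPS G-ne3p1-40 of the cell `pub-balaban`.
-/

noncomputable section

open Finset Real Matrix

namespace Summit.QuantumFields.BalabanUV.T4Continuum.SliceFlatOperators

open Literature.MathematicalPhysics.QuantumFieldTheory.Balaban1983to89
open Literature.MathematicalPhysics.QuantumFieldTheory.Balaban1983to89.TreeLengthTorus (TPt)
open Literature.MathematicalPhysics.QuantumFieldTheory.Balaban1983to89.B5Prop11Plancherel (Tor fine)
open Literature.MathematicalPhysics.QuantumFieldTheory.Balaban1983to89.B5DeltaA169 (DeltaA)
open Literature.MathematicalPhysics.QuantumFieldTheory.Balaban1983to89.B5RealFields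
  (reM DeltaAR GR LapR GR_mul_DeltaAR DeltaAR_mul_GR DeltaAR_posDef)
open Literature.MathematicalPhysics.QuantumFieldTheory.Balaban1983to89.B9Thm37GlueTorusCov (Comb)
open Literature.MathematicalPhysics.QuantumFieldTheory.Balaban1983to89.T4SliceOperatorData (massKernel)
open Summit.QuantumFields.BalabanUV.T4Continuum.SliceTorusBlocks
open Summit.QuantumFields.BalabanUV.T4Continuum.SliceTorusTower
open Summit.QuantumFields.BalabanUV.T4Continuum.SliceCovariantModel
open Summit.QuantumFields.BalabanUV.T4Continuum.SliceCovariantTower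
open Summit.QuantumFields.BalabanUV.T4Continuum.SliceCovariantSkeleton
open Summit.QuantumFields.BalabanUV.T4Continuum.SliceCovariantPrincipal
open Summit.QuantumFields.BalabanUV.T4Continuum.SliceTorusComb
open Summit.QuantumFields.BalabanUV.T4Continuum.SliceFlatPropagator

/-! ## §1  Reindexed real operators of pv15 on the NE3 carrier: `kFlat`, `gFlat`, inverses, positivity -/
section Reindexed

variable (d k N L : ℕ) [NeZero N] [NeZero L]

/-- The product reindexing `Tor (fine n M) × Fin (d+1) ≃ TPt (d+1) (N·L^k) × Fin (d+1)` of level `j`. [model] [folklore] -/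
def PhiF (j : ℕ) : Tor (fine (side k L j) (Mlev d k N L j)) × Fin (d + 1) ≃ TPt (d + 1) (N * L ^ k) × Fin (d + 1) :=
  (Equiv.prodCongr (eF d k N L j) (Equiv.refl _)).symm

/-- Reindexing a matrix of pv15's level-`j` fine torus to the NE3 carrier. [model] [folklore] -/
def RI (j : ℕ) (A : Matrix (Tor (fine (side k L j) (Mlev d k N L j)) × Fin (d + 1))
    (Tor (fine (side k L j) (Mlev d k N L j)) × Fin (d + 1)) ℝ) :
    Matrix (TPt (d + 1) (N * L ^ k) × Fin (d + 1)) (TPt (d + 1) (N * L ^ k) × Fin (d + 1)) ℝ :=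
  Matrix.reindex (PhiF d k N L j) (PhiF d k N L j) A

omit [NeZero N] [NeZero L] in
/-- Entries of a reindexed matrix. [folklore] -/
theorem RI_apply (j : ℕ) (A : Matrix (Tor (fine (side k L j) (Mlev d k N L j)) × Fin (d + 1))
    (Tor (fine (side k L j) (Mlev d k N L j)) × Fin (d + 1)) ℝ) (p q : TPt (d + 1) (N * L ^ k) × Fin (d + 1)) :
    RI d k N L j A p q = A (eF d k N L j p.1, p.2) (eF d k N L j q.1, q.2) := rfl

/-- Reindexing is multiplicative. [folklore] -/
theorem RI_mul (j : ℕ) (A B : Matrix (Tor (fine (side k L j) (Mlev d k N L j)) × Fin (d + 1))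
    (Tor (fine (side k L j) (Mlev d k N L j)) × Fin (d + 1)) ℝ) :
    RI d k N L j (A * B) = RI d k N L j A * RI d k N L j B := by
  unfold RI
  rw [Matrix.reindex_apply, Matrix.reindex_apply, Matrix.reindex_apply, Matrix.submatrix_mul_equiv]

omit [NeZero N] [NeZero L] in
/-- Reindexing preserves the identity. [folklore] -/
theorem RI_one (j : ℕ) : RI d k N L j (1 : Matrix _ _ ℝ) = 1 := by
  unfold RI
  rw [Matrix.reindex_apply, Matrix.submatrix_one_equiv]

omit [NeZero N] [NeZero L] in
/-- Reindexing is linear over real scalars. [folklore] -/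
theorem RI_smul (j : ℕ) (c : ℝ) (A : Matrix (Tor (fine (side k L j) (Mlev d k N L j)) × Fin (d + 1))
    (Tor (fine (side k L j) (Mlev d k N L j)) × Fin (d + 1)) ℝ) : RI d k N L j (c • A) = c • RI d k N L j A := by
  unfold RI; rw [Matrix.reindex_apply, Matrix.reindex_apply, Matrix.submatrix_smul]; rfl

omit [NeZero N] [NeZero L] in
/-- Reindexing is additive. [folklore] -/
theorem RI_add (j : ℕ) (A B : Matrix (Tor (fine (side k L j) (Mlev d k N L j)) × Fin (d + 1))
    (Tor (fine (side k L j) (Mlev d k N L j)) × Fin (d + 1)) ℝ) : RI d k N L j (A + B) = RI d k N L j A + RI d k N L j B := by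
  unfold RI; rw [Matrix.reindex_apply, Matrix.reindex_apply, Matrix.reindex_apply, Matrix.submatrix_add]; rfl

omit [NeZero N] [NeZero L] in
/-- Reindexing preserves positive definiteness. [folklore] -/
theorem RI_posDef (j : ℕ) {A : Matrix (Tor (fine (side k L j) (Mlev d k N L j)) × Fin (d + 1))
    (Tor (fine (side k L j) (Mlev d k N L j)) × Fin (d + 1)) ℝ} (hA : A.PosDef) : (RI d k N L j A).PosDef := by
  unfold RI
  rw [Matrix.reindex_apply]
  exact hA.submatrix (PhiF d k N L j).symm.injective

/-- **THE FLAT LEVEL-`j` OPERATOR ON THE NE3 CARRIER, unit-lattice normalisation**: `K_j := η_j² · Re Δ_1` of [B5] (1.73)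
(pv15's real matrix `B5RealFields.DeltaAR n M 1`, `n = L^{min(j,k)}`, `η_j = 1/n`) reindexed. [model] -/
def kFlat (j : ℕ) : Matrix (TPt (d + 1) (N * L ^ k) × Fin (d + 1)) (TPt (d + 1) (N * L ^ k) × Fin (d + 1)) ℝ :=
  ((side k L j : ℝ) ^ 2)⁻¹ • RI d k N L j (DeltaAR (side k L j) (Mlev d k N L j) 1)

/-- Part 1's `gFlat j` IS `η_j⁻² ·` pv15's real Green's matrix `GR` reindexed (both are real parts of `(DeltaA)⁻¹`). [folklore] -/
theorem gFlat_eq (j : ℕ) :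
    gFlat d k N L j = ((side k L j : ℝ) ^ 2) • RI d k N L j (GR (side k L j) (Mlev d k N L j) 1) := by
  ext p q
  rw [Matrix.smul_apply, RI_apply, smul_eq_mul]
  rfl

/-- `K_j · G_j = 1` on the NE3 carrier (pv15's `DeltaAR_mul_GR`, [B5] (1.71), transported). [folklore] -/
theorem kFlat_mul_gFlat (j : ℕ) : kFlat d k N L j * gFlat d k N L j = 1 := by
  have hn : (0 : ℝ) < (side k L j : ℝ) ^ 2 := by
    have := one_le_side k L j; positivity
  rw [gFlat_eq, kFlat, Matrix.smul_mul, Matrix.mul_smul, smul_smul, inv_mul_cancel₀ hn.ne', one_smul, ← RI_mul,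
    DeltaAR_mul_GR _ (one_le_side k L j) _ _ one_pos, RI_one]

/-- `G_j · K_j = 1` on the NE3 carrier. [folklore] -/
theorem gFlat_mul_kFlat (j : ℕ) : gFlat d k N L j * kFlat d k N L j = 1 := by
  have hn : (0 : ℝ) < (side k L j : ℝ) ^ 2 := by
    have := one_le_side k L j; positivity
  rw [gFlat_eq, kFlat, Matrix.smul_mul, Matrix.mul_smul, smul_smul, mul_inv_cancel₀ hn.ne', one_smul, ← RI_mul,
    GR_mul_DeltaAR _ (one_le_side k L j) _ _ one_pos, RI_one]

/-- Hence `gFlat j = (kFlat j)⁻¹`. [folklore] -/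
theorem kFlat_inv (j : ℕ) : (kFlat d k N L j)⁻¹ = gFlat d k N L j := Matrix.inv_eq_left_inv (gFlat_mul_kFlat d k N L j)

/-- **POSITIVITY of the flat level operators** ([B5] p. 30 «At first let us prove that Δ_a is a positive operator» — pv15's
theorem `DeltaAR_posDef`, transported and scaled by `η_j² > 0`). [folklore] -/
theorem kFlat_posDef (j : ℕ) : (kFlat d k N L j).PosDef := by
  have hn : (0 : ℝ) < ((side k L j : ℝ) ^ 2)⁻¹ := by
    have := one_le_side k L j; positivity
  have hR := RI_posDef d k N L j (DeltaAR_posDef (side k L j) (one_le_side k L j) (Mlev d k N L j) 1 one_pos)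
  unfold kFlat
  exact hR.smul hn

end Reindexed

/-! ## §2  The flat data of the covariant skeleton -/
section FlatData

variable (d k N L : ℕ) [NeZero N] [NeZero L]

/-- The FLAT background: identity transport on every bond (`U = 1`). [model] [folklore] -/
def flatRm : TBond (d + 1) (N * L ^ k) → Fin (d + 1) → Fin (d + 1) → ℝ := fun _ μ ν => if μ = ν then 1 else 0

omit [NeZero N] [NeZero L] in
/-- The flat transport is isometric (the binder `hRm`). [folklore] -/
theorem flatRm_isometric (b : TBond (d + 1) (N * L ^ k)) (i j : Fin (d + 1)) :
    ∑ m, flatRm d k N L b m i * flatRm d k N L b m j = if i = j then (1 : ℝ) else 0 :=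
  flat_isometric (d + 1) k N L (Fin (d + 1)) b i j

/-- The LEVEL-FREE PRINCIPAL PART of the flat family: the unit vector Laplacian `Σ_ν ∇_ν*∇_ν` on `(ℤ/NL^k)^{d+1} × Fin (d+1)`,
realised as pv15's `LapR` at level `0` (`η = 1`) reindexed. [model] -/
def flatE : Matrix (TPt (d + 1) (N * L ^ k) × Fin (d + 1)) (TPt (d + 1) (N * L ^ k) × Fin (d + 1)) ℝ :=
  RI d k N L 0 (LapR (side k L 0) (Mlev d k N L 0))

/-- The mass coefficients of the flat family: Bałaban's `a = 1` at every level (pv15's convention). [model] [folklore] -/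
def flatAm : ℕ → ℝ := fun _ => 1

/-- THE REMAINDER FORM of the flat family: `N_j := K_j − E − massKernel_j` — DEFINED as the remainder; it contains
Bałaban's gauge part `−η_j²∂P_j∂*` of [B5] (1.69)–(1.70), the deviation of the line-averaged `a·Q*Q` of (1.8) from the
block-diagonal mass model `massKernel (cubeI j) τ_j (1/(L^j)^{d+3})`, and `η_j²·Δ_j − E` (zero, unproved here). [model] -/
def flatNg (j : ℕ) : Matrix (TPt (d + 1) (N * L ^ k) × Fin (d + 1)) (TPt (d + 1) (N * L ^ k) × Fin (d + 1)) ℝ :=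
  kFlat d k N L j - flatE d k N L
    - massKernel (cubeI (d + 1) k N L (Fin (d + 1)) j) (tau (cubeComb (d + 1) k N L j) (flatRm d k N L))
        (flatAm j / ((L : ℝ) ^ j) ^ (d + 1 + 2))

end FlatData

/-! ## §3  The flat propagators ARE `gLevE` at the flat data; positivity and (3.42) item 0 for `gLevE` -/
section Identification

variable (d k N L : ℕ) [NeZero N] [NeZero L]

/-- **`kLevE` AT THE FLAT DATA IS `kFlat`**: `E + (a_j·Q_jᵀQ_j + N_j) = K_j` with `E = flatE`, the tower combs, the flat
transport, Bałaban's normalisation `wB`/`aB` at `a = 1`, and `N_j = flatNg j`. [folklore] -/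
theorem kLevE_flat (j : ℕ) :
    kLevE (flatE d k N L) (cubeComb (d + 1) k N L) (flatRm d k N L) (wB L (d + 1)) (aB L (d + 1) flatAm)
        (flatNg d k N L) j = kFlat d k N L j := by
  unfold kLevE
  rw [kPart_eq_massKernel (cubeComb (d + 1) k N L) (flatRm d k N L) flatAm (flatNg d k N L)
    (cubeComb_blk (d + 1) k N L) j]
  unfold flatNg
  abel

/-- **`gLevE` AT THE FLAT DATA IS `gFlat`** — the flat auxiliary propagator of part 1 is the operator of the lineage's
one type at `U = 1`. [folklore] -/
theorem gLevE_flat (j : ℕ) :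
    gLevE (flatE d k N L) (cubeComb (d + 1) k N L) (flatRm d k N L) (wB L (d + 1)) (aB L (d + 1) flatAm)
        (flatNg d k N L) j = gFlat d k N L j := by
  unfold gLevE
  rw [kLevE_flat, kFlat_inv]

/-- **POSITIVITY AT THE FLAT DATA IS A THEOREM** (the content of `hT311` ∕ [B9] Theorem 3.11 at `U = 1` = [B5] Prop. 1.1,
pv15's `DeltaAR_posDef`). [folklore] -/
theorem posDef_kLevE_flat (j : ℕ) :
    (kLevE (flatE d k N L) (cubeComb (d + 1) k N L) (flatRm d k N L) (wB L (d + 1)) (aB L (d + 1) flatAm)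
        (flatNg d k N L) j).PosDef := by
  rw [kLevE_flat]; exact kFlat_posDef d k N L j

/-- **(3.42) ITEM 0 IN KERNEL FORM FOR `gLevE` AT THE FLAT DATA — PROVED**, level-free constants `flatB₀ d`, `flatδ₀ d`
(part 1's `gFlat_rowBound` through `gLevE_flat`): the binder `hG` of `SliceTorusSkeleton.sliceKernel_bound_torus_of_kernelBounds`
∕ the `m = 0` clause of the stability reading `hT31` of `SliceCovariantPrincipal.ne3Shape_torusCovE_of_printedStatements`,
for the operator family of the lineage's one type at `U = 1`. [folklore] -/
theorem gLevE_flat_rowBound (j : ℕ) (p : TPt (d + 1) (N * L ^ k) × Fin (d + 1)) (y₁ : TPt (d + 1) (levM k N L j)) :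
    ∑ z ∈ Finset.univ.filter (fun z => cubeI (d + 1) k N L (Fin (d + 1)) j z = y₁),
        |gLevE (flatE d k N L) (cubeComb (d + 1) k N L) (flatRm d k N L) (wB L (d + 1)) (aB L (d + 1) flatAm)
          (flatNg d k N L) j p z|
      ≤ flatB₀ d * ((L : ℝ) ^ j) ^ 2
        * Real.exp (-(flatδ₀ d * nbd (d + 1) k N L j (cubeI (d + 1) k N L (Fin (d + 1)) j p) y₁)) := by
  rw [gLevE_flat]; exact gFlat_rowBound d k N L j p y₁

/-- **RESOLVENT TELESCOPING AT THE FLAT DATA, hypothesis-free**: the slices of the flat family sum to a row of `G_k·D`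
(`SliceCovariantPrincipal.sum_sliceKernel_covE` with its positivity hypothesis DISCHARGED by `posDef_kLevE_flat`). [folklore] -/
theorem sum_sliceKernel_flat (D : Matrix (TPt (d + 1) (N * L ^ k) × Fin (d + 1)) (TPt (d + 1) (N * L ^ k) × Fin (d + 1)) ℝ)
    (kk : ℕ) (x y : TPt (d + 1) (N * L ^ k) × Fin (d + 1)) :
    ∑ i ∈ Finset.range (kk + 1),
        T4SliceTelescoping.sliceKernel
          (gLevE (flatE d k N L) (cubeComb (d + 1) k N L) (flatRm d k N L) (wB L (d + 1)) (aB L (d + 1) flatAm)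
            (flatNg d k N L))
          (kPart (cubeComb (d + 1) k N L) (flatRm d k N L) (wB L (d + 1)) (aB L (d + 1) flatAm) (flatNg d k N L)) D i x y
      = (gFlat d k N L kk * D) x y := by
  rw [← gLevE_flat]
  exact sum_sliceKernel_covE (posDef_kLevE_flat d k N L) D kk x y

end Identification

end Summit.QuantumFields.BalabanUV.T4Continuum.SliceFlatOperators
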